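import Literature.Probability.Process.BrownianVec
import Literature.Probability.Process.StoppedMartingale
import Mathlib.Probability.Process.FiniteDimensionalLaws
import Mathlib.MeasureTheory.Measure.HasOuterApproxClosed
import Mathlib.Probability.Independence.Integration
import Mathlib.Probability.IdentDistrib
import HarnessLib

/-!
# The strong Markov property of `d`-dimensional Brownian motion

Topic `Literature/Probability/Process` (companion of `BrownianVec`, whose hypothesis structure
`IsBrownianVec W P` — measurable marginals, continuous paths, `W₀ = 0`, weak Markov property at
fixed times — it strengthens). Everything here is PROVED; no named fact and no definition beyond
the increment process `vecIncrAfter` is introduced.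

This is the vector-valued transliteration of `RandomPlanarGeometry/BrownianStrongMarkov` (the
canonical one-dimensional case), written for an arbitrary process `W : ℝ≥0 → Ω → (Fin d → ℝ)`
satisfying `IsBrownianVec W P` and its raw natural filtration `hW.natFiltration`: for a stopping
time `τ`, with `Z^τ_u = W_{τ+u} - W_τ` (`vecIncrAfter W τ u`, read on `{τ < ∞}`),

* `setIntegral_comp_vecIncrAfter_of_countable_range`, `setIntegral_comp_vecIncrAfter` —
  `E[G(Z^τ); A ∩ {τ < ∞}] = E[G(W)] · P[A ∩ {τ < ∞}]` for `A ∈ 𝓕_τ` and bounded `G` (measurable;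
  and continuous for the product topology in the general case), by Le Gall's proof of Thm. 2.20
  (countable range: sum over the values + weak Markov; general: dyadic approximation from above +
  dominated convergence along continuous paths);
* `map_vecIncrAfter_restrict_eq` — the measure form on the path space `ℝ≥0 → (Fin d → ℝ)`
  (finite-dimensional marginals + `IsProjectiveLimit.unique`);
* `measure_vecIncrAfter_mem_inter`, and for a.s. finite `τ`: `identDistrib_vecIncrAfter`
  (`Z^τ` has the law of `W`), `indep_vecIncrAfter` (`σ(Z^τ) ⊥ 𝓕_τ`), `indepFun_vecIncrAfter`;
* `measureReal_stoppedValue_vecIncrAfter_mem_eq_integral` — the factorised form for events of the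
  pair (position `x₀ + W_τ`, increments `Z^τ`): `P{(x₀ + W_τ, Z^τ) ∈ E} = E[ψ(x₀ + W_τ)]`,
  `ψ(a) = P{(a, W) ∈ E}` (as used in exit problems restarted at a hitting time, e.g. Durrett (2019)
  Thm. 9.1.4).

It is the input of the planar (two-dimensional) renewal arguments for Brownian intersection
exponents (restarting two independent planar motions at their exit times of discs).

## References

* J.-F. Le Gall, *Brownian Motion, Martingales, and Stochastic Calculus*, Springer GTM 274 (2016),
  Thm. 2.20 (strong Markov property, stated for `d`-dimensional Brownian motion) and Prop. 3.8.
  [Legall2016]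
* D. Revuz, M. Yor, *Continuous Martingales and Brownian Motion* (1999), Ch. III, Thm. (3.1).
-/

noncomputable section

open MeasureTheory ProbabilityTheory Filter Set Function
open scoped NNReal ENNReal Topology

namespace Literature.Probability.Process

variable {Ω : Type*} {mΩ : MeasurableSpace Ω} {P : Measure Ω} {d : ℕ}
  {W : ℝ≥0 → Ω → (Fin d → ℝ)}

/-! ### The increments after a random time -/

/-- **The increments after the random time `τ`**: `Z^τ_u(ω) = W_{τ(ω)+u}(ω) - W_{τ(ω)}(ω)` (read on
`{τ < ∞}`; junk via `WithTop.untopA` on `{τ = ∞}`). Le Gall (2016), Thm. 2.20.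
[cite: Legall2016, Thm. 2.20] -/
def vecIncrAfter (W : ℝ≥0 → Ω → (Fin d → ℝ)) (τ : Ω → WithTop ℝ≥0) (u : ℝ≥0) (ω : Ω) :
    Fin d → ℝ :=
  W ((τ ω).untopA + u) ω - W (τ ω).untopA ω

/-- Unfolding lemma. [folklore] -/
theorem vecIncrAfter_apply (τ : Ω → WithTop ℝ≥0) (u : ℝ≥0) (ω : Ω) :
    vecIncrAfter W τ u ω = W ((τ ω).untopA + u) ω - W (τ ω).untopA ω := rfl

/-- On `{τ = r}` the increments after `τ` are the increments after the fixed time `r`, i.e. the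
shifted path `vecShift W r`. [folklore] -/
theorem vecIncrAfter_of_eq_coe {τ : Ω → WithTop ℝ≥0} {ω : Ω} {r : ℝ≥0} (h : τ ω = r) (u : ℝ≥0) :
    vecIncrAfter W τ u ω = vecShift W r ω u := by
  rw [vecIncrAfter_apply, h]
  rfl

namespace IsBrownianVec

/-- A Brownian vector process is jointly measurable in `(t, ω)`. [folklore] -/
theorem measurable_uncurry (hW : IsBrownianVec W P) : Measurable (Function.uncurry W) :=
  measurable_uncurry_of_continuous_of_measurable hW.continuous_path hW.measurable

/-- `ω ↦ W_{ρ(ω)}(ω)` is measurable for a measurable random time `ρ`. [folklore] -/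
theorem measurable_randomTime (hW : IsBrownianVec W P) {ρ : Ω → ℝ≥0} (hρ : Measurable ρ) :
    Measurable fun ω ↦ W (ρ ω) ω :=
  hW.measurable_uncurry.comp (hρ.prodMk measurable_id)

/-- The increment process after `τ` has continuous paths. [folklore] -/
theorem continuous_vecIncrAfter (hW : IsBrownianVec W P) (τ : Ω → WithTop ℝ≥0) (ω : Ω) :
    Continuous fun u ↦ vecIncrAfter W τ u ω :=
  ((hW.continuous_path ω).comp (continuous_const.add continuous_id)).sub continuous_const

/-- Each coordinate of the increment process after a measurable random time is measurable.
[folklore] -/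
theorem measurable_vecIncrAfter (hW : IsBrownianVec W P) {τ : Ω → WithTop ℝ≥0}
    (hτ : Measurable τ) (u : ℝ≥0) : Measurable (vecIncrAfter W τ u) :=
  (hW.measurable_randomTime (hτ.untopA.add_const u)).sub (hW.measurable_randomTime hτ.untopA)

/-- The increment process after a measurable random time is a measurable random path.
[folklore] -/
theorem measurable_vecIncrAfter_pi (hW : IsBrownianVec W P) {τ : Ω → WithTop ℝ≥0}
    (hτ : Measurable τ) : Measurable fun ω u ↦ vecIncrAfter W τ u ω :=
  measurable_pi_lambda _ fun u ↦ hW.measurable_vecIncrAfter hτ u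

/-- The shifted path at a fixed time has the law of the path. [folklore] -/
theorem identDistrib_vecShift (hW : IsBrownianVec W P) (r : ℝ≥0) :
    IdentDistrib (vecShift W r) (vecPath W) P P :=
  ⟨(hW.measurable_vecShift r).aemeasurable, hW.measurable_vecPath.aemeasurable, hW.map_shift r⟩

/-! ### The weak Markov property at a fixed time, in integrated form -/

/-- **Weak Markov property, integrated against an event of the past.** For `E ∈ 𝓕_r` and a
measurable functional `G` of the path, `E[G(W_{r+·} - W_r); E] = E[G(W)] · P[E]`.
[cite: Legall2016, Prop. 2.5 (ii)] -/
theorem setIntegral_comp_vecShift [IsProbabilityMeasure P] (hW : IsBrownianVec W P) (r : ℝ≥0)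
    {E : Set Ω} (hE : MeasurableSet[hW.natFiltration r] E) {G : (ℝ≥0 → (Fin d → ℝ)) → ℝ}
    (hGm : Measurable G) :
    ∫ ω in E, G (vecShift W r ω) ∂P = (∫ ω, G (vecPath W ω) ∂P) * P.real E := by
  have hEm : MeasurableSet E := (hW.natFiltration.le r) _ hE
  -- independence of `G ∘ vecShift` and the indicator of `E`
  have hind : IndepFun (fun ω ↦ G (vecShift W r ω)) (E.indicator fun _ ↦ (1 : ℝ)) P := by
    rw [IndepFun_iff_Indep]
    refine indep_of_indep_of_le_right (indep_of_indep_of_le_left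
      (hW.indep_comap_vecShift_natFiltration r) ?_) ?_
    · exact (hGm.comp (comap_measurable (vecShift W r))).comap_le
    · exact ((measurable_const (a := (1 : ℝ))).indicator hE).comap_le
  have hlaw : ∫ ω, G (vecShift W r ω) ∂P = ∫ ω, G (vecPath W ω) ∂P :=
    ((hW.identDistrib_vecShift r).comp hGm).integral_eq
  calc ∫ ω in E, G (vecShift W r ω) ∂P
      = ∫ ω, G (vecShift W r ω) * E.indicator (fun _ ↦ (1 : ℝ)) ω ∂P := by
        rw [← integral_indicator hEm]
        congr 1; funext ω
        by_cases hω : ω ∈ E <;> simp [hω]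
    _ = (∫ ω, G (vecShift W r ω) ∂P) * ∫ ω, E.indicator (fun _ ↦ (1 : ℝ)) ω ∂P :=
        hind.integral_fun_mul_eq_mul_integral (hGm.comp (hW.measurable_vecShift r)).aestronglyMeasurable
          ((measurable_const.indicator hEm).aestronglyMeasurable)
    _ = _ := by rw [hlaw, integral_indicator hEm, setIntegral_const, smul_eq_mul, mul_one]

/-! ### Stopping times with countably many values -/

/-- **Strong Markov property at a stopping time with countable range.** For a stopping time `τ`
of the natural filtration with countably many values, `A ∈ 𝓕_τ`, and a bounded measurable
functional `G` of the path, `E[G(Z^τ); A ∩ {τ < ∞}] = E[G(W)] · P[A ∩ {τ < ∞}]`. Le Gall (2016),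
proof of Thm. 2.20, first step. [cite: Legall2016, Thm. 2.20] -/
theorem setIntegral_comp_vecIncrAfter_of_countable_range [IsProbabilityMeasure P]
    (hW : IsBrownianVec W P) {τ : Ω → WithTop ℝ≥0} (hτ : IsStoppingTime hW.natFiltration τ)
    (hcount : (Set.range τ).Countable) {A : Set Ω} (hA : MeasurableSet[hτ.measurableSpace] A)
    {G : (ℝ≥0 → (Fin d → ℝ)) → ℝ} (hGm : Measurable G) {C : ℝ} (hGb : ∀ w, |G w| ≤ C) :
    ∫ ω in A ∩ {ω | τ ω ≠ ⊤}, G (fun u ↦ vecIncrAfter W τ u ω) ∂P =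
      (∫ ω, G (vecPath W ω) ∂P) * P.real (A ∩ {ω | τ ω ≠ ⊤}) := by
  -- the countable set of finite values
  set S : Set ℝ≥0 := {q | ((q : ℝ≥0) : WithTop ℝ≥0) ∈ Set.range τ} with hS
  have hSc : S.Countable := hcount.preimage WithTop.coe_injective
  haveI : Countable S := hSc.to_subtype
  -- the pieces
  set E : S → Set Ω := fun q ↦ A ∩ {ω | τ ω = ((q : ℝ≥0) : WithTop ℝ≥0)} with hEdef
  have hEq : ∀ q : S, MeasurableSet[hW.natFiltration (q : ℝ≥0)] (E q) := by
    intro q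
    have h1 : MeasurableSet[hτ.measurableSpace] (E q) :=
      hA.inter (hτ.measurableSet_eq_of_countable_range' hcount _)
    exact (hτ.measurableSet_inter_eq_iff A (q : ℝ≥0)).1 h1
  have hEm : ∀ q : S, MeasurableSet (E q) := fun q ↦ (hW.natFiltration.le _) _ (hEq q)
  have hdisj : Pairwise (Disjoint on E) := by
    intro p q hpq
    rw [Function.onFun, Set.disjoint_left]
    rintro ω ⟨-, hp⟩ ⟨-, hq'⟩
    apply hpq
    apply Subtype.ext
    have : ((p : ℝ≥0) : WithTop ℝ≥0) = ((q : ℝ≥0) : WithTop ℝ≥0) := by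
      rw [Set.mem_setOf_eq] at hp hq'
      rw [← hp, ← hq']
    exact_mod_cast this
  have hUnion : (⋃ q, E q) = A ∩ {ω | τ ω ≠ ⊤} := by
    ext ω
    simp only [Set.mem_iUnion, Set.mem_inter_iff, Set.mem_setOf_eq, hEdef]
    constructor
    · rintro ⟨q, hωA, hq⟩
      exact ⟨hωA, by rw [hq]; exact WithTop.coe_ne_top⟩
    · rintro ⟨hωA, hne⟩
      obtain ⟨r, hr⟩ := WithTop.ne_top_iff_exists.1 hne
      exact ⟨⟨r, ⟨ω, hr.symm⟩⟩, hωA, hr.symm⟩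
  -- integrability of the bounded integrand
  set g : Ω → ℝ := fun ω ↦ G (fun u ↦ vecIncrAfter W τ u ω) with hg
  have hgm : Measurable g := hGm.comp (hW.measurable_vecIncrAfter_pi hτ.measurable')
  have hC0 : 0 ≤ C := (abs_nonneg _).trans (hGb fun _ ↦ 0)
  have hgi : Integrable g P :=
    (integrable_const C).mono' hgm.aestronglyMeasurable
      (Eventually.of_forall fun ω ↦ by rw [Real.norm_eq_abs]; exact hGb _)
  -- the sum over the pieces
  have hsum : HasSum (fun q ↦ ∫ ω in E q, g ω ∂P) (∫ ω in A ∩ {ω | τ ω ≠ ⊤}, g ω ∂P) := by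
    rw [← hUnion]
    exact hasSum_integral_iUnion hEm hdisj hgi.integrableOn
  have hsum1 : HasSum (fun q ↦ P.real (E q)) (P.real (A ∩ {ω | τ ω ≠ ⊤})) := by
    have h := hasSum_integral_iUnion (f := fun _ ↦ (1 : ℝ)) (μ := P) hEm hdisj
      (integrable_const (1 : ℝ)).integrableOn
    rw [hUnion] at h
    simpa only [integral_const, smul_eq_mul, mul_one, Measure.restrict_apply MeasurableSet.univ,
      Set.univ_inter, measureReal_def] using h
  -- each piece, by the weak Markov property at `q`
  set K : ℝ := ∫ ω, G (vecPath W ω) ∂P with hK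
  have hpiece : ∀ q : S, ∫ ω in E q, g ω ∂P = K * P.real (E q) := by
    intro q
    have hcongr : ∫ ω in E q, g ω ∂P = ∫ ω in E q, G (vecShift W (q : ℝ≥0) ω) ∂P := by
      refine setIntegral_congr_fun (hEm q) fun ω hω ↦ ?_
      simp only [hg]
      congr 1; funext u
      exact vecIncrAfter_of_eq_coe hω.2 u
    rw [hcongr]
    exact hW.setIntegral_comp_vecShift (q : ℝ≥0) (hEq q) hGm
  have hsum2 : HasSum (fun q ↦ ∫ ω in E q, g ω ∂P) (K * P.real (A ∩ {ω | τ ω ≠ ⊤})) := by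
    simp_rw [hpiece]
    exact hsum1.mul_left K
  exact hsum.unique hsum2

/-! ### Arbitrary stopping times -/

/-- The event `{τ < ∞}` of a stopping time is measurable. [folklore] -/
theorem measurableSet_ne_top (hW : IsBrownianVec W P) {τ : Ω → WithTop ℝ≥0}
    (hτ : IsStoppingTime hW.natFiltration τ) : MeasurableSet {ω | τ ω ≠ ⊤} :=
  hτ.measurableSet_eq_top.compl

/-- **Strong Markov property, integrated form** (Le Gall (2016), Thm. 2.20, `d`-dimensional). For a
stopping time `τ` of the natural filtration, `A ∈ 𝓕_τ`, and a functional `G` of the path which is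
bounded, measurable and continuous for the product topology,
`E[G(Z^τ); A ∩ {τ < ∞}] = E[G(W)] · P[A ∩ {τ < ∞}]`. [cite: Legall2016, Thm. 2.20] -/
theorem setIntegral_comp_vecIncrAfter [IsProbabilityMeasure P] (hW : IsBrownianVec W P)
    {τ : Ω → WithTop ℝ≥0} (hτ : IsStoppingTime hW.natFiltration τ) {A : Set Ω}
    (hA : MeasurableSet[hτ.measurableSpace] A) {G : (ℝ≥0 → (Fin d → ℝ)) → ℝ} (hGm : Measurable G)
    (hGc : Continuous G) {C : ℝ} (hGb : ∀ w, |G w| ≤ C) :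
    ∫ ω in A ∩ {ω | τ ω ≠ ⊤}, G (fun u ↦ vecIncrAfter W τ u ω) ∂P =
      (∫ ω, G (vecPath W ω) ∂P) * P.real (A ∩ {ω | τ ω ≠ ⊤}) := by
  set τn : ℕ → Ω → WithTop ℝ≥0 := fun n ω ↦ dyadicCeilTop n (τ ω) with hτndef
  have hτn : ∀ n, IsStoppingTime hW.natFiltration (τn n) := fun n ↦
    hτ.isOptionalTime.isStoppingTime_dyadicCeilTop n
  have hcount : ∀ n, (Set.range (τn n)).Countable := fun n ↦
    (countable_range_dyadicCeilTop n).mono (Set.range_comp_subset_range τ (dyadicCeilTop n))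
  have hle : ∀ n ω, τ ω ≤ τn n ω := fun n ω ↦ le_dyadicCeilTop n (τ ω)
  have hAn : ∀ n, MeasurableSet[(hτn n).measurableSpace] A := fun n ↦
    IsStoppingTime.measurableSpace_mono hτ (hτn n) (hle n) _ hA
  have hset : ∀ n, A ∩ {ω | τn n ω ≠ ⊤} = A ∩ {ω | τ ω ≠ ⊤} := by
    intro n
    ext ω
    simp only [Set.mem_inter_iff, Set.mem_setOf_eq, hτndef, and_congr_right_iff]
    intro _
    induction τ ω using WithTop.recTopCoe with
    | top => simp
    | coe r => simp only [dyadicCeilTop_coe, ne_eq, WithTop.coe_ne_top, not_false_eq_true]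
  have hAm : MeasurableSet (A ∩ {ω | τ ω ≠ ⊤}) :=
    (hτ.measurableSpace_le _ hA).inter (hW.measurableSet_ne_top hτ)
  set K : ℝ := ∫ ω, G (vecPath W ω) ∂P with hK
  have hn : ∀ n, ∫ ω in A ∩ {ω | τ ω ≠ ⊤}, G (fun u ↦ vecIncrAfter W (τn n) u ω) ∂P =
      K * P.real (A ∩ {ω | τ ω ≠ ⊤}) := by
    intro n
    rw [← hset n]
    exact hW.setIntegral_comp_vecIncrAfter_of_countable_range (hτn n) (hcount n) (hAn n) hGm hGb
  -- pointwise convergence on `{τ < ∞}`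
  have hptw : ∀ ω, τ ω ≠ ⊤ → Tendsto (fun n ↦ G (fun u ↦ vecIncrAfter W (τn n) u ω)) atTop
      (𝓝 (G (fun u ↦ vecIncrAfter W τ u ω))) := by
    intro ω hω
    obtain ⟨r, hr⟩ := WithTop.ne_top_iff_exists.1 hω
    refine (hGc.tendsto _).comp ?_
    rw [tendsto_pi_nhds]
    intro u
    have h1 : ∀ n, vecIncrAfter W (τn n) u ω = W (dyadicCeil n r + u) ω - W (dyadicCeil n r) ω :=
      fun n ↦ vecIncrAfter_of_eq_coe (by simp only [hτndef, ← hr, dyadicCeilTop_coe]) u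
    have h2 : vecIncrAfter W τ u ω = W (r + u) ω - W r ω := vecIncrAfter_of_eq_coe hr.symm u
    simp_rw [h1, h2]
    have hc := hW.continuous_path ω
    exact ((hc.tendsto _).comp ((tendsto_dyadicCeil r).add tendsto_const_nhds)).sub
      ((hc.tendsto _).comp (tendsto_dyadicCeil r))
  -- dominated convergence
  have hlim : Tendsto (fun n ↦ ∫ ω in A ∩ {ω | τ ω ≠ ⊤}, G (fun u ↦ vecIncrAfter W (τn n) u ω) ∂P)
      atTop (𝓝 (∫ ω in A ∩ {ω | τ ω ≠ ⊤}, G (fun u ↦ vecIncrAfter W τ u ω) ∂P)) := by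
    refine tendsto_integral_of_dominated_convergence (fun _ ↦ C) (fun n ↦ ?_) (integrable_const C)
      (fun n ↦ Eventually.of_forall fun ω ↦ by rw [Real.norm_eq_abs]; exact hGb _) ?_
    · exact (hGm.comp (hW.measurable_vecIncrAfter_pi (hτn n).measurable')).aestronglyMeasurable
    · rw [ae_restrict_iff' hAm]
      exact Eventually.of_forall fun ω hω ↦ hptw ω hω.2
  have hconst : Tendsto (fun n ↦ ∫ ω in A ∩ {ω | τ ω ≠ ⊤},
      G (fun u ↦ vecIncrAfter W (τn n) u ω) ∂P) atTop (𝓝 (K * P.real (A ∩ {ω | τ ω ≠ ⊤}))) := by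
    simp_rw [hn]
    exact tendsto_const_nhds
  exact tendsto_nhds_unique hlim hconst

/-- `Finset.restrict` on the vector path space is continuous for the product topologies.
[folklore] -/
theorem continuous_finsetRestrict_vec (I : Finset ℝ≥0) :
    Continuous (I.restrict : (ℝ≥0 → (Fin d → ℝ)) → (I → (Fin d → ℝ))) :=
  continuous_pi fun i ↦ continuous_apply (i : ℝ≥0)

/-- **Strong Markov property, measure form.** For a stopping time `τ` and `A ∈ 𝓕_τ`, the image
of `P` restricted to `A ∩ {τ < ∞}` under `Z^τ` is `P[A ∩ {τ < ∞}]` times the law of the path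
`W` (as measures on `ℝ≥0 → (Fin d → ℝ)` with the product σ-algebra).
[cite: Legall2016, Thm. 2.20] -/
theorem map_vecIncrAfter_restrict_eq [IsProbabilityMeasure P] (hW : IsBrownianVec W P)
    {τ : Ω → WithTop ℝ≥0} (hτ : IsStoppingTime hW.natFiltration τ) {A : Set Ω}
    (hA : MeasurableSet[hτ.measurableSpace] A) :
    (P.restrict (A ∩ {ω | τ ω ≠ ⊤})).map (fun ω u ↦ vecIncrAfter W τ u ω) =
      P (A ∩ {ω | τ ω ≠ ⊤}) • P.map (vecPath W) := by
  set c : ℝ≥0∞ := P (A ∩ {ω | τ ω ≠ ⊤}) with hc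
  set Z : Ω → ℝ≥0 → (Fin d → ℝ) := fun ω u ↦ vecIncrAfter W τ u ω with hZ
  have hZm : Measurable Z := hW.measurable_vecIncrAfter_pi hτ.measurable'
  set μ₁ : Measure (ℝ≥0 → (Fin d → ℝ)) := (P.restrict (A ∩ {ω | τ ω ≠ ⊤})).map Z with hμ₁
  set μ₂ : Measure (ℝ≥0 → (Fin d → ℝ)) := c • P.map (vecPath W) with hμ₂
  haveI hPB : IsProbabilityMeasure (P.map (vecPath W)) :=
    Measure.isProbabilityMeasure_map hW.measurable_vecPath.aemeasurable
  haveI : IsFiniteMeasure μ₂ := by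
    refine ⟨?_⟩
    rw [hμ₂, Measure.smul_apply, measure_univ, smul_eq_mul, mul_one]
    exact measure_lt_top _ _
  have hfdd : ∀ I : Finset ℝ≥0, μ₁.map I.restrict = μ₂.map I.restrict := by
    intro I
    apply ext_of_forall_integral_eq_of_IsFiniteMeasure
    intro f
    have hfm : Measurable fun w : ℝ≥0 → (Fin d → ℝ) ↦ f (I.restrict w) :=
      f.continuous.measurable.comp (Finset.measurable_restrict I)
    have hfb : ∀ w : ℝ≥0 → (Fin d → ℝ), |f (I.restrict w)| ≤ ‖f‖ := fun w ↦ by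
      rw [← Real.norm_eq_abs]; exact f.norm_coe_le_norm _
    rw [integral_map (Finset.measurable_restrict I).aemeasurable f.continuous.aestronglyMeasurable,
      integral_map (Finset.measurable_restrict I).aemeasurable f.continuous.aestronglyMeasurable,
      hμ₁, integral_map hZm.aemeasurable hfm.aestronglyMeasurable, hμ₂, integral_smul_measure,
      integral_map hW.measurable_vecPath.aemeasurable hfm.aestronglyMeasurable]
    rw [hW.setIntegral_comp_vecIncrAfter hτ hA hfm (f.continuous.comp (continuous_finsetRestrict_vec I))
      hfb]
    rw [measureReal_def, ← hc, smul_eq_mul, mul_comm]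
  have h₁ : IsProjectiveLimit μ₁ (fun I : Finset ℝ≥0 ↦ μ₁.map I.restrict) := fun _ ↦ rfl
  have h₂ : IsProjectiveLimit μ₂ (fun I : Finset ℝ≥0 ↦ μ₁.map I.restrict) := fun I ↦ (hfdd I).symm
  exact h₁.unique h₂

/-- **Strong Markov property, for events.** For a stopping time `τ`, `A ∈ 𝓕_τ` and a measurable set
`S` of paths, `P[Z^τ ∈ S, A, τ < ∞] = P[W ∈ S] · P[A, τ < ∞]`. [cite: Legall2016, Thm. 2.20] -/
theorem measure_vecIncrAfter_mem_inter [IsProbabilityMeasure P] (hW : IsBrownianVec W P)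
    {τ : Ω → WithTop ℝ≥0} (hτ : IsStoppingTime hW.natFiltration τ) {A : Set Ω}
    (hA : MeasurableSet[hτ.measurableSpace] A) {S : Set (ℝ≥0 → (Fin d → ℝ))} (hS : MeasurableSet S) :
    P ((fun ω u ↦ vecIncrAfter W τ u ω) ⁻¹' S ∩ (A ∩ {ω | τ ω ≠ ⊤})) =
      P (vecPath W ⁻¹' S) * P (A ∩ {ω | τ ω ≠ ⊤}) := by
  have hZm : Measurable fun ω u ↦ vecIncrAfter W τ u ω := hW.measurable_vecIncrAfter_pi hτ.measurable'
  have h := congrArg (fun μ : Measure (ℝ≥0 → (Fin d → ℝ)) ↦ μ S) (hW.map_vecIncrAfter_restrict_eq hτ hA)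
  rw [Measure.map_apply hZm hS, Measure.restrict_apply (hZm hS), Measure.smul_apply,
    Measure.map_apply hW.measurable_vecPath hS, smul_eq_mul] at h
  rw [h, mul_comm]

/-! ### Almost surely finite stopping times -/

omit [MeasurableSpace Ω] in
/-- For an a.s. finite random time, intersecting with `{τ < ∞}` does not change probabilities.
[folklore] -/
theorem measure_inter_ne_top' {mΩ : MeasurableSpace Ω} {P : Measure Ω} {τ : Ω → WithTop ℝ≥0}
    (hfin : ∀ᵐ ω ∂P, τ ω ≠ ⊤) (A : Set Ω) : P (A ∩ {ω | τ ω ≠ ⊤}) = P A := by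
  apply measure_inter_conull
  rw [Set.compl_setOf]
  exact ae_iff.1 hfin

omit [MeasurableSpace Ω] in
/-- For an a.s. finite random time, `{τ < ∞}` has probability one. [folklore] -/
theorem measure_ne_top_eq_one' {mΩ : MeasurableSpace Ω} {P : Measure Ω} [IsProbabilityMeasure P]
    {τ : Ω → WithTop ℝ≥0} (hfin : ∀ᵐ ω ∂P, τ ω ≠ ⊤) : P {ω | τ ω ≠ ⊤} = 1 := by
  rw [← Set.univ_inter {ω | τ ω ≠ ⊤}, measure_inter_ne_top' hfin, measure_univ]

/-- **Strong Markov property, law** (Le Gall (2016), Thm. 2.20): for an a.s. finite stopping time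
`τ`, the process `Z^τ_u = W_{τ+u} - W_τ` has the law of the path `W`. [cite: Legall2016, Thm. 2.20] -/
theorem identDistrib_vecIncrAfter [IsProbabilityMeasure P] (hW : IsBrownianVec W P)
    {τ : Ω → WithTop ℝ≥0} (hτ : IsStoppingTime hW.natFiltration τ) (hfin : ∀ᵐ ω ∂P, τ ω ≠ ⊤) :
    IdentDistrib (fun ω u ↦ vecIncrAfter W τ u ω) (vecPath W) P P := by
  have hZm : Measurable fun ω u ↦ vecIncrAfter W τ u ω := hW.measurable_vecIncrAfter_pi hτ.measurable'
  refine ⟨hZm.aemeasurable, hW.measurable_vecPath.aemeasurable, ?_⟩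
  have h := hW.map_vecIncrAfter_restrict_eq hτ (A := Set.univ) (@MeasurableSet.univ _ hτ.measurableSpace)
  have hfin' : ∀ᵐ ω ∂P, ω ∈ {ω | τ ω ≠ ⊤} := hfin
  rw [Set.univ_inter, Measure.restrict_eq_self_of_ae_mem hfin', measure_ne_top_eq_one' hfin,
    one_smul] at h
  exact h

/-- **Strong Markov property, independence** (Le Gall (2016), Thm. 2.20): for an a.s. finite
stopping time `τ`, the σ-algebra generated by `Z^τ` is independent of `𝓕_τ`.
[cite: Legall2016, Thm. 2.20] -/
theorem indep_vecIncrAfter [IsProbabilityMeasure P] (hW : IsBrownianVec W P)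
    {τ : Ω → WithTop ℝ≥0} (hτ : IsStoppingTime hW.natFiltration τ) (hfin : ∀ᵐ ω ∂P, τ ω ≠ ⊤) :
    Indep (MeasurableSpace.comap (fun ω u ↦ vecIncrAfter W τ u ω) MeasurableSpace.pi)
      hτ.measurableSpace P := by
  rw [Indep_iff]
  rintro t1 t2 ⟨S, hS, rfl⟩ ht2
  have h1 := hW.measure_vecIncrAfter_mem_inter hτ ht2 hS
  have h2 := hW.measure_vecIncrAfter_mem_inter hτ (@MeasurableSet.univ _ hτ.measurableSpace) hS
  rw [← Set.inter_assoc, measure_inter_ne_top' hfin, measure_inter_ne_top' hfin] at h1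
  rw [Set.univ_inter, measure_inter_ne_top' hfin, measure_ne_top_eq_one' hfin, mul_one] at h2
  rw [h1, h2]

/-- **Strong Markov property, independence from `𝓕_τ`-measurable data**: for an a.s. finite
stopping time `τ`, `Z^τ` is independent of every `𝓕_τ`-measurable random variable.
[cite: Legall2016, Thm. 2.20] -/
theorem indepFun_vecIncrAfter [IsProbabilityMeasure P] (hW : IsBrownianVec W P) {𝒳 : Type*}
    [MeasurableSpace 𝒳] {τ : Ω → WithTop ℝ≥0} (hτ : IsStoppingTime hW.natFiltration τ)
    (hfin : ∀ᵐ ω ∂P, τ ω ≠ ⊤) {X : Ω → 𝒳} (hX : Measurable[hτ.measurableSpace] X) :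
    IndepFun (fun ω u ↦ vecIncrAfter W τ u ω) X P := by
  rw [IndepFun_iff_Indep]
  exact indep_of_indep_of_le_right (hW.indep_vecIncrAfter hτ hfin) hX.comap_le

/-! ### The strong Markov property for events of (position at `τ`, increments after `τ`) -/

/-- **Strong Markov factorisation for events of the pair (position, future increments)** (the
form of Le Gall's Thm. 2.20 / Durrett's Thm. 7.3.9 used in exit problems restarted at a hitting
time, e.g. Durrett's proof of Thm. 9.1.4: "`P_x(A_n^c) = E_x(P_{B(S_n)}(…))`"). For an a.s. finite
stopping time `τ` of the natural filtration, a starting point `x₀` and a measurable set `E` of pairs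
(point, path):
`P{(x₀ + W_τ, (W_{τ+u} − W_τ)_u) ∈ E} = E[ψ(x₀ + W_τ)]` with `ψ(a) = P{(a, W) ∈ E}` —
`W_τ` is `𝓕_τ`-measurable (continuous adapted paths are progressively measurable), `Z^τ` is
independent of `𝓕_τ` (`indepFun_vecIncrAfter`) and has the law of `W` (`identDistrib_vecIncrAfter`).
[cite: Legall2016, Thm. 2.20] -/
theorem measureReal_stoppedValue_vecIncrAfter_mem_eq_integral [IsProbabilityMeasure P]
    (hW : IsBrownianVec W P) (x₀ : Fin d → ℝ) {τ : Ω → WithTop ℝ≥0}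
    (hτ : IsStoppingTime hW.natFiltration τ) (hfin : ∀ᵐ ω ∂P, τ ω ≠ ⊤)
    {E : Set ((Fin d → ℝ) × (ℝ≥0 → (Fin d → ℝ)))} (hE : MeasurableSet E) :
    P.real {ω | (x₀ + stoppedValue W τ ω, fun u ↦ vecIncrAfter W τ u ω) ∈ E} =
      ∫ ω, P.real {ω' | (x₀ + stoppedValue W τ ω, vecPath W ω') ∈ E} ∂P := by
  have hprog : IsStronglyProgressive hW.natFiltration W :=
    hW.stronglyAdapted.isStronglyProgressive_of_continuous hW.continuous_path
  set U : Ω → (Fin d → ℝ) := fun ω ↦ x₀ + stoppedValue W τ ω with hU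
  have hUm' : Measurable[hτ.measurableSpace] U :=
    measurable_const.add (measurable_stoppedValue hprog hτ)
  have hUm : Measurable U := hUm'.mono hτ.measurableSpace_le le_rfl
  set ξ : Ω → (ℝ≥0 → (Fin d → ℝ)) := fun ω u ↦ vecIncrAfter W τ u ω with hξ
  have hξm : Measurable ξ := hW.measurable_vecIncrAfter_pi hτ.measurable'
  have hind : IndepFun U ξ P := (hW.indepFun_vecIncrAfter hτ hfin hUm').symm
  have hmap : P.map ξ = P.map (vecPath W) := (hW.identDistrib_vecIncrAfter hτ hfin).map_eq
  have key := integral_comp_eq_integral_integral_of_indepFun hUm hξm hind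
    ((measurable_const (a := (1 : ℝ))).indicator hE) (C := 1) fun p ↦ by
      by_cases hp : p ∈ E <;> simp [hp]
  -- left side
  have hL : ∫ ω, E.indicator (fun _ ↦ (1 : ℝ)) (U ω, ξ ω) ∂P =
      P.real {ω | (x₀ + stoppedValue W τ ω, fun u ↦ vecIncrAfter W τ u ω) ∈ E} := by
    have hfun : (fun ω ↦ E.indicator (fun _ ↦ (1 : ℝ)) (U ω, ξ ω)) =
        ((fun ω ↦ (U ω, ξ ω)) ⁻¹' E).indicator 1 := by
      funext ω
      rfl
    rw [hfun, integral_indicator_one ((hUm.prodMk hξm) hE)]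
    rfl
  -- right side, inner integral
  have hR : ∀ ω, ∫ e, E.indicator (fun _ ↦ (1 : ℝ)) (U ω, e) ∂(P.map ξ) =
      P.real {ω' | (x₀ + stoppedValue W τ ω, vecPath W ω') ∈ E} := by
    intro ω
    rw [hmap]
    have hslice : MeasurableSet (Prod.mk (U ω) ⁻¹' E) := measurable_prodMk_left hE
    have hfun : (fun e ↦ E.indicator (fun _ ↦ (1 : ℝ)) (U ω, e)) =
        (Prod.mk (U ω) ⁻¹' E).indicator 1 := by
      funext e
      rfl
    have hset : {ω' | (x₀ + stoppedValue W τ ω, vecPath W ω') ∈ E} =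
        vecPath W ⁻¹' (Prod.mk (U ω) ⁻¹' E) := rfl
    rw [hfun, integral_indicator_one hslice, hset, Measure.real, Measure.real,
      Measure.map_apply hW.measurable_vecPath hslice]
  rw [← hL, key]
  exact integral_congr_ae (ae_of_all _ hR)

end IsBrownianVec

end Literature.Probability.Process
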